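import Summits.Ventures.PercRepro.S1CoreCapSixFinal
import Summits.Ventures.PercRepro.S1CoreCapSevenThreeNon

/-!
# PercRepro — THE `s₄` TABLE WITH `Q*(7) = 19`, UNCONDITIONAL (p1, gen 26)

With `Q*(7) = 19` a kernel theorem (`FourCap.Seven.fourCapSpec_seven`) the spec instances `j ≤ 7` are all theorems
(`fourCapSpec_qStar_le_seven_unconditional`), so on the e-free core of nullity `7` the number of 4-circuits
through a point is `≤ 19` (`ncard_fourCircuitsThrough_le_nineteen`) and `s₄ ≤ 64` (the cap sum
`1 + 4 + 5 + 8 + 11 + 16 + 19`, `ncard_fourCircuits_le_sixty_four_unconditional`, from `67`). The averaging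
recursion of `S1CoreCapAvg` then gives `s₄ ≤ 92 / 128 / 174` at nullity `8 / 9 / 10` (from `96 / 134 / 182`) and in
general `s₄ ≤ avgBoundSeven k` at nullity `k + 7`, `avgBoundSeven 0 = 64`, `avgBoundSeven (k + 1) =
⌊(k + 13) · avgBoundSeven k / (k + 9)⌋` (`ncard_fourCircuits_le_avgBoundSeven`). No `FourCapSpec` hypothesis
anywhere. `proofs/P1-S4-CAPBRIDGE.md` §18. Axioms: standard.
-/

open scoped Matroid

namespace PercRepro

namespace S1

open Set

open FourCap

variable {α : Type}

/-- The instances `j ≤ 7` of the spec are all kernel theorems. -/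
theorem fourCapSpec_qStar_le_seven_unconditional : ∀ j ≤ 7, FourCapSpec capPaper j (qStar j) := by
  intro j hj
  rcases (by omega : j ≤ 6 ∨ j = 7) with h | rfl
  · exact fourCapSpec_qStar_le_six_unconditional j h
  · exact Seven.fourCapSpec_seven

/-- **At most `19` 4-circuits through any point of an e-free core of nullity `7`** (the bridge with `Q*(7) = 19`). -/
theorem ncard_fourCircuitsThrough_le_nineteen (M : Matroid α) [M.Finite]
    (hfree : ∀ e ∈ M.E, ∃ A ⊆ M.E \ {e}, e ∉ M.closure A ∧ e ∉ M.closure ((M.E \ {e}) \ A))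
    (hd : M.E.encard = M.eRank + 7) {e : α} (he : e ∈ M.E) :
    {C : Set α | M.IsCircuit C ∧ C.ncard = 4 ∧ e ∈ C}.ncard ≤ 19 :=
  ncard_fourCircuitsThrough_le_of_fourCapSpec M hfree hd he Seven.fourCapSpec_seven

/-- **`s₄ ≤ 64` on every e-free core of nullity `7`**, unconditionally (from `67`). -/
theorem ncard_fourCircuits_le_sixty_four_unconditional (M : Matroid α) [M.Finite]
    (hfree : ∀ e ∈ M.E, ∃ A ⊆ M.E \ {e}, e ∉ M.closure A ∧ e ∉ M.closure ((M.E \ {e}) \ A))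
    (hd : M.E.encard = M.eRank + 7) : {C : Set α | M.IsCircuit C ∧ C.ncard = 4}.ncard ≤ 64 := by
  have := ncard_fourCircuits_le_capSum M hfree hd qStar fourCapSpec_qStar_le_seven_unconditional
  rwa [capSum_qStar_seven] at this

/-- **The averaging table from `64`**: `avgBoundSeven k` bounds `s₄` at nullity `k + 7` — `64` at `k = 0`, then
`⌊(k + 13) · avgBoundSeven k / (k + 9)⌋`: `64, 92, 128, 174, 232, 303, 389, …`. -/
def avgBoundSeven : ℕ → ℕ
  | 0 => 64
  | k + 1 => (k + 13) * avgBoundSeven k / (k + 9)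

/-- **`s₄ ≤ avgBoundSeven k` on every e-free core of nullity `k + 7`**, unconditionally (induction on `k` with the
averaging recursion of `S1CoreCapAvg`). -/
theorem ncard_fourCircuits_le_avgBoundSeven (k : ℕ) : ∀ (M : Matroid α) [M.Finite],
    (∀ e ∈ M.E, ∃ A ⊆ M.E \ {e}, e ∉ M.closure A ∧ e ∉ M.closure ((M.E \ {e}) \ A)) →
    M.E.encard = M.eRank + (k + 7) → {C : Set α | M.IsCircuit C ∧ C.ncard = 4}.ncard ≤ avgBoundSeven k := by
  induction k with
  | zero =>
    intro M _ hfree hd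
    exact ncard_fourCircuits_le_sixty_four_unconditional M hfree hd
  | succ k ih =>
    intro M _ hfree hd
    have hd' : M.E.encard = M.eRank + ((k + 7) + 1) := by
      rw [hd]; congr 1
    have h := ncard_fourCircuits_sub_div_le M hfree (d := k + 7) hd' (by omega)
      (fun M' _ hfree' hd'' => ih M' hfree' hd'')
    have h' := le_mul_div_of_sub_div_le (m := k + 7 + 6) (by omega) h
    simp only [avgBoundSeven]
    have e1 : k + 7 + 6 = k + 13 := by omega
    have e2 : k + 7 + 6 - 4 = k + 9 := by omega
    rw [e1, e2] at h'
    exact h'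

/-- The first values of the table from `64`. -/
theorem avgBoundSeven_values : avgBoundSeven 1 = 92 ∧ avgBoundSeven 2 = 128 ∧ avgBoundSeven 3 = 174 ∧
    avgBoundSeven 4 = 232 ∧ avgBoundSeven 5 = 303 ∧ avgBoundSeven 6 = 389 := by decide

/-- **`s₄ ≤ 92` on every e-free core of nullity `8`**, unconditionally (from `96`). -/
theorem ncard_fourCircuits_le_ninety_two_unconditional (M : Matroid α) [M.Finite]
    (hfree : ∀ e ∈ M.E, ∃ A ⊆ M.E \ {e}, e ∉ M.closure A ∧ e ∉ M.closure ((M.E \ {e}) \ A))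
    (hd : M.E.encard = M.eRank + 8) : {C : Set α | M.IsCircuit C ∧ C.ncard = 4}.ncard ≤ 92 := by
  have := ncard_fourCircuits_le_avgBoundSeven 1 M hfree hd
  rwa [avgBoundSeven_values.1] at this

/-- **`s₄ ≤ 128` on every e-free core of nullity `9`**, unconditionally (from `134`). -/
theorem ncard_fourCircuits_le_one_hundred_twenty_eight_unconditional (M : Matroid α) [M.Finite]
    (hfree : ∀ e ∈ M.E, ∃ A ⊆ M.E \ {e}, e ∉ M.closure A ∧ e ∉ M.closure ((M.E \ {e}) \ A))
    (hd : M.E.encard = M.eRank + 9) : {C : Set α | M.IsCircuit C ∧ C.ncard = 4}.ncard ≤ 128 := by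
  have := ncard_fourCircuits_le_avgBoundSeven 2 M hfree hd
  rwa [avgBoundSeven_values.2.1] at this

end S1

end PercRepro
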